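import Mathlib.CategoryTheory.Skeletal
import Literature.AlgebraicGeometry.Frobenioids.Dissection
import Literature.AlgebraicGeometry.Frobenioids.EquivalenceTransport
import Literature.AlgebraicGeometry.Frobenioids.NumberFieldLocalizationsFSMFFProofs
import HarnessLib

/-!
# Frobenioids II, §0 (p. 6): totally / continuously ordered monomorphisms via isomorphism classes of
# `C^↣_φ`, and invariance of the ordered "types" under equivalences of categories

Mochizuki, *The geometry of Frobenioids II: poly-Frobenioids*, Kyushu J. Math. **62** (2008)
401–460, §0 "Notations and Conventions", paragraph **Categories**, kurims text p. 6
[cite: MochizukiFrdII2008, §0 p.6]: a monomorphism `φ : A ↣ B` is *totally ordered* if the category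
`C^↣_φ` of factorizations of `φ` through monomorphisms "is equivalent to a category of the form
`Order(E)` …, where `E` is a totally ordered set [so `E` may be recovered as the set of isomorphism
classes of `C^↣_φ`, with the order relation determined by the arrows of `C^↣_φ`]"; *continuously
ordered* if moreover `E` is densely ordered; and the six "types" of categories (strictly partially /
discontinuously / totally / quasi-totally / continuously / quasi-continuously ordered) — typed in
`Dissection.lean` (abc-iut-L1-t4: `IsTotallyOrderedHom`, `IsContinuouslyOrderedHom`,
`MonoFactorisations`, `IsOf…OrderedType`).

This PROOF-ONLY file (no definitions, no instances) makes the bracketed remark a theorem and uses it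
to show that these notions are invariants of the category up to equivalence:

* `isTotallyOrderedHom_iff` — **the bracket on p. 6**: `φ` is totally ordered iff `φ` is a
  monomorphism and any two objects of `C^↣_φ` are comparable (joined by an arrow in one direction);
  then `E` = the thin skeleton (isomorphism classes) of `C^↣_φ`, which is always a thin category
  (`NFLoc.subsingleton_hom_monoFactorisations`).  `isContinuouslyOrderedHom_iff`: the same plus the
  order-density of `C^↣_φ` stated with arrows.  Both criteria are free of the auxiliary universe of `E`.
* `comparable_transfer`, `dense_transfer`: comparability / density pass along any correspondence of
  objects of two categories that is essentially surjective both ways and matches arrows.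
* For an equivalence `e : C ≌ D`: mono-factorisations of `φ` and of `e(φ)` correspond
  (`MonoFactorisations.exists_preimage_equivalence`, `….exists_image_equivalence`,
  `….nonempty_hom_iff_equivalence`), whence `isTotallyOrderedHom_map_equivalence_iff`,
  `isContinuouslyOrderedHom_map_equivalence_iff`, and the invariance of four of the six types:
  `isOf{Totally,Continuously,StrictlyPartially,Discontinuously}OrderedType_iff_of_equivalence`.
  (The two "quasi" types need, in addition, invariance under composition with isomorphisms; they are
  treated in the sequel file.)

Elementary category theory over Mathlib's `ThinSkeleton` / `Equivalence`; nothing here bears on the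
disputed [IUTchIII] Cor. 3.12 or takes a side; no FACT-LIST row is asserted (abc-iut cell, seat
abc-iut-f-031, by-product of tranche 31 `IsOfTotallyOrderedType` F-2333 / `IsOfQuasiTotallyOrderedType`
F-2334).
-/

namespace Literature.AlgebraicGeometry.Frobenioids

open CategoryTheory

universe v₁ v₂ v₃ v₄ u₁ u₂ u₃ u₄

/-! ### Comparability and density pass along correspondences -/

section Transfer

variable {K : Type u₃} [Category.{v₃} K] {K' : Type u₄} [Category.{v₄} K']

/-- If the objects of two categories correspond by a relation `R` that reaches every object of `K'`
and matches arrows, and any two objects of `K` are joined by an arrow in some direction, then so are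
any two objects of `K'` (used for `C^↣_φ` versus `D^↣_{e(φ)}`). [cite: MochizukiFrdII2008, §0 p.6] -/
theorem comparable_transfer (R : K → K' → Prop) (hsurj : ∀ G' : K', ∃ G : K, R G G')
    (hhom : ∀ {G₁ G₂ : K} {G₁' G₂' : K'}, R G₁ G₁' → R G₂ G₂' →
      (Nonempty (G₁ ⟶ G₂) ↔ Nonempty (G₁' ⟶ G₂')))
    (htot : ∀ G₁ G₂ : K, Nonempty (G₁ ⟶ G₂) ∨ Nonempty (G₂ ⟶ G₁)) (G₁' G₂' : K') :
    Nonempty (G₁' ⟶ G₂') ∨ Nonempty (G₂' ⟶ G₁') := by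
  obtain ⟨G₁, h₁⟩ := hsurj G₁'
  obtain ⟨G₂, h₂⟩ := hsurj G₂'
  exact (htot G₁ G₂).imp (hhom h₁ h₂).mp (hhom h₂ h₁).mp

/-- If the objects of two categories correspond by a relation `R` that reaches every object on both
sides and matches arrows, then order-density of the arrow preorder ("between two non-isomorphic
comparable objects lies a third") passes from `K` to `K'`. [cite: MochizukiFrdII2008, §0 p.6] -/
theorem dense_transfer (R : K → K' → Prop) (hsurj : ∀ G' : K', ∃ G : K, R G G')
    (hsurj' : ∀ G : K, ∃ G' : K', R G G')
    (hhom : ∀ {G₁ G₂ : K} {G₁' G₂' : K'}, R G₁ G₁' → R G₂ G₂' →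
      (Nonempty (G₁ ⟶ G₂) ↔ Nonempty (G₁' ⟶ G₂')))
    (hdense : ∀ G₁ G₂ : K, Nonempty (G₁ ⟶ G₂) → IsEmpty (G₂ ⟶ G₁) →
      ∃ G₃ : K, Nonempty (G₁ ⟶ G₃) ∧ IsEmpty (G₃ ⟶ G₁) ∧ Nonempty (G₃ ⟶ G₂) ∧ IsEmpty (G₂ ⟶ G₃))
    (G₁' G₂' : K') (h₁₂ : Nonempty (G₁' ⟶ G₂')) (h₂₁ : IsEmpty (G₂' ⟶ G₁')) :
    ∃ G₃' : K', Nonempty (G₁' ⟶ G₃') ∧ IsEmpty (G₃' ⟶ G₁') ∧ Nonempty (G₃' ⟶ G₂') ∧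
      IsEmpty (G₂' ⟶ G₃') := by
  obtain ⟨G₁, h₁⟩ := hsurj G₁'
  obtain ⟨G₂, h₂⟩ := hsurj G₂'
  obtain ⟨G₃, h₁₃, h₃₁, h₃₂, h₂₃⟩ := hdense G₁ G₂ ((hhom h₁ h₂).mpr h₁₂)
    (not_nonempty_iff.mp fun h => h₂₁.false ((hhom h₂ h₁).mp h).some)
  obtain ⟨G₃', h₃⟩ := hsurj' G₃
  exact ⟨G₃', (hhom h₁ h₃).mp h₁₃, not_nonempty_iff.mp fun h => h₃₁.false ((hhom h₃ h₁).mpr h).some,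
    (hhom h₃ h₂).mp h₃₂, not_nonempty_iff.mp fun h => h₂₃.false ((hhom h₂ h₃).mpr h).some⟩

end Transfer

/-! ### The bracket on p. 6: `E` = isomorphism classes of `C^↣_φ` -/

section Criteria

variable {C : Type u₁} [Category.{v₁} C]

/-- **FrdII §0 p. 6, the bracketed remark as a criterion.**  A morphism `φ` is totally ordered iff it
is a monomorphism and any two objects of `C^↣_φ` are joined by an arrow (in some direction): then the
set `E` of isomorphism classes of `C^↣_φ`, ordered by the arrows, is totally ordered and
`C^↣_φ ≃ Order(E)` ("`E` may be recovered as the set of isomorphism classes of `C^↣_φ`, with the order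
relation determined by the arrows of `C^↣_φ`"); conversely comparability is read off any equivalence
`C^↣_φ ≃ Order(E)`.  (`C^↣_φ` is always thin: `NFLoc.subsingleton_hom_monoFactorisations`.)
[cite: MochizukiFrdII2008, §0 p.6] -/
theorem isTotallyOrderedHom_iff {A B : C} (φ : A ⟶ B) :
    IsTotallyOrderedHom φ ↔ Mono φ ∧
      ∀ G₁ G₂ : MonoFactorisations φ, Nonempty (G₁ ⟶ G₂) ∨ Nonempty (G₂ ⟶ G₁) := by
  constructor
  · rintro ⟨hm, E, instE, ⟨e⟩⟩
    refine ⟨hm, fun G₁ G₂ => ?_⟩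
    rcases le_total (e.functor.obj G₁) (e.functor.obj G₂) with hle | hle
    · exact Or.inl ⟨e.functor.preimage hle.hom⟩
    · exact Or.inr ⟨e.functor.preimage hle.hom⟩
  · rintro ⟨hm, htot⟩
    haveI : Quiver.IsThin (MonoFactorisations φ) := NFLoc.subsingleton_hom_monoFactorisations
    letI instLO : LinearOrder (ThinSkeleton (MonoFactorisations φ)) :=
      { (inferInstance : PartialOrder (ThinSkeleton (MonoFactorisations φ))) with
        le_total := fun x y => Quotient.inductionOn₂ x y fun G₁ G₂ => htot G₁ G₂
        toDecidableLE := Classical.decRel _ }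
    exact ⟨hm, ThinSkeleton (MonoFactorisations φ), instLO,
      ⟨(ThinSkeleton.equivalence (MonoFactorisations φ)).symm⟩⟩

/-- **FrdII §0 p. 6, continuously ordered, as a criterion.**  `φ` is continuously ordered iff it is a
monomorphism, any two objects of `C^↣_φ` are comparable, and `C^↣_φ` is densely ordered: whenever
`G₁ → G₂` with no arrow back, some `G₃` receives an arrow from `G₁` and maps to `G₂`, with no arrows
`G₃ → G₁`, `G₂ → G₃` (i.e. the isomorphism classes form a densely ordered set).
[cite: MochizukiFrdII2008, §0 p.6] -/
theorem isContinuouslyOrderedHom_iff {A B : C} (φ : A ⟶ B) :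
    IsContinuouslyOrderedHom φ ↔ Mono φ ∧
      (∀ G₁ G₂ : MonoFactorisations φ, Nonempty (G₁ ⟶ G₂) ∨ Nonempty (G₂ ⟶ G₁)) ∧
      ∀ G₁ G₂ : MonoFactorisations φ, Nonempty (G₁ ⟶ G₂) → IsEmpty (G₂ ⟶ G₁) →
        ∃ G₃ : MonoFactorisations φ, Nonempty (G₁ ⟶ G₃) ∧ IsEmpty (G₃ ⟶ G₁) ∧
          Nonempty (G₃ ⟶ G₂) ∧ IsEmpty (G₂ ⟶ G₃) := by
  constructor
  · rintro ⟨hm, E, instE, hdense, ⟨e⟩⟩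
    refine ⟨hm, ((isTotallyOrderedHom_iff φ).mp ⟨hm, E, instE, ⟨e⟩⟩).2, ?_⟩
    rintro G₁ G₂ ⟨f⟩ h₂₁
    have hlt : e.functor.obj G₁ < e.functor.obj G₂ :=
      lt_of_le_not_ge (e.functor.map f).le fun hle => h₂₁.false (e.functor.preimage hle.hom)
    obtain ⟨c, hac, hcb⟩ := exists_between hlt
    refine ⟨e.inverse.obj c, ⟨e.unit.app G₁ ≫ e.inverse.map hac.le.hom⟩,
      ⟨fun g => hac.not_ge ((e.counitInv.app c ≫ e.functor.map g).le)⟩,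
      ⟨e.inverse.map hcb.le.hom ≫ e.unitInv.app G₂⟩,
      ⟨fun g => hcb.not_ge ((e.functor.map g ≫ e.counit.app c).le)⟩⟩
  · rintro ⟨hm, htot, hdense⟩
    haveI : Quiver.IsThin (MonoFactorisations φ) := NFLoc.subsingleton_hom_monoFactorisations
    letI instLO : LinearOrder (ThinSkeleton (MonoFactorisations φ)) :=
      { (inferInstance : PartialOrder (ThinSkeleton (MonoFactorisations φ))) with
        le_total := fun x y => Quotient.inductionOn₂ x y fun G₁ G₂ => htot G₁ G₂
        toDecidableLE := Classical.decRel _ }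
    have instD : DenselyOrdered (ThinSkeleton (MonoFactorisations φ)) := by
      refine ⟨fun x y => Quotient.inductionOn₂ x y fun G₁ G₂ hlt => ?_⟩
      obtain ⟨G₃, ⟨f₁₃⟩, h₃₁, ⟨f₃₂⟩, h₂₃⟩ :=
        hdense G₁ G₂ hlt.le (not_nonempty_iff.mp fun h => hlt.not_ge h)
      exact ⟨ThinSkeleton.mk G₃, lt_of_le_not_ge ⟨f₁₃⟩ fun ⟨g⟩ => h₃₁.false g,
        lt_of_le_not_ge ⟨f₃₂⟩ fun ⟨g⟩ => h₂₃.false g⟩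
    exact ⟨hm, ThinSkeleton (MonoFactorisations φ), instLO, instD,
      ⟨(ThinSkeleton.equivalence (MonoFactorisations φ)).symm⟩⟩

end Criteria

/-! ### Mono-factorisations of `φ` and of `e(φ)` correspond -/

section Equivalence

variable {C : Type u₁} [Category.{v₁} C] {D : Type u₂} [Category.{v₂} D] (e : C ≌ D)

/-- Every mono-factorisation `e(A) ↣ X' ↣ e(B)` of `e(φ)` is isomorphic to the image of a
mono-factorisation `A ↣ e⁻¹X' ↣ B` of `φ` (legs pulled back by full faithfulness; they are
monomorphisms because `e` reflects monomorphisms). [cite: MochizukiFrdII2008, §0 p.6] -/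
theorem MonoFactorisations.exists_preimage_equivalence {A B : C} {φ : A ⟶ B}
    (G' : MonoFactorisations (e.functor.map φ)) :
    ∃ (G : MonoFactorisations φ) (k : e.functor.obj G.obj.mid ≅ G'.obj.mid),
      e.functor.map G.obj.ι ≫ k.hom = G'.obj.ι ∧ k.hom ≫ G'.obj.π = e.functor.map G.obj.π := by
  have hG' : Mono G'.obj.ι ∧ Mono G'.obj.π := G'.property
  haveI := hG'.1
  haveI := hG'.2
  obtain ⟨ι, hι⟩ := exists_preimage_from e G'.obj.ι
  obtain ⟨π, hπ⟩ := exists_preimage_to e G'.obj.π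
  have hιπ : ι ≫ π = φ := e.functor.map_injective (by
    rw [Functor.map_comp, hι, hπ, Category.assoc, Iso.inv_hom_id_assoc, G'.obj.ι_π])
  have hmι : Mono ι := e.functor.mono_of_mono_map (by rw [hι]; infer_instance)
  have hmπ : Mono π := e.functor.mono_of_mono_map (by rw [hπ]; infer_instance)
  refine ⟨⟨{ mid := e.functor.objPreimage G'.obj.mid, ι := ι, π := π, ι_π := hιπ }, ⟨hmι, hmπ⟩⟩,
    e.functor.objObjPreimageIso G'.obj.mid, ?_, ?_⟩
  · show e.functor.map ι ≫ _ = _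
    rw [hι, Category.assoc, Iso.inv_hom_id, Category.comp_id]
  · show _ = e.functor.map π
    rw [hπ]

/-- The image `e(A) ↣ e(X) ↣ e(B)` of a mono-factorisation of `φ` is a mono-factorisation of `e(φ)`.
[cite: MochizukiFrdII2008, §0 p.6] -/
theorem MonoFactorisations.exists_image_equivalence {A B : C} {φ : A ⟶ B}
    (G : MonoFactorisations φ) :
    ∃ (G' : MonoFactorisations (e.functor.map φ)) (k : e.functor.obj G.obj.mid ≅ G'.obj.mid),
      e.functor.map G.obj.ι ≫ k.hom = G'.obj.ι ∧ k.hom ≫ G'.obj.π = e.functor.map G.obj.π := by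
  have hG : Mono G.obj.ι ∧ Mono G.obj.π := G.property
  haveI := hG.1
  haveI := hG.2
  refine ⟨⟨{ mid := e.functor.obj G.obj.mid
             ι := e.functor.map G.obj.ι
             π := e.functor.map G.obj.π
             ι_π := by rw [← Functor.map_comp, G.obj.ι_π] }, ⟨inferInstance, inferInstance⟩⟩,
    Iso.refl _, ?_, ?_⟩
  · exact Category.comp_id _
  · exact Category.id_comp _

/-- Under such isomorphisms, arrows of `C^↣_φ` and of `D^↣_{e(φ)}` correspond (push forward and
conjugate; pull back by full faithfulness). [cite: MochizukiFrdII2008, §0 p.6] -/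
theorem MonoFactorisations.nonempty_hom_iff_equivalence {A B : C} {φ : A ⟶ B}
    {G₁ G₂ : MonoFactorisations φ} {G₁' G₂' : MonoFactorisations (e.functor.map φ)}
    (k₁ : e.functor.obj G₁.obj.mid ≅ G₁'.obj.mid) (h₁ι : e.functor.map G₁.obj.ι ≫ k₁.hom = G₁'.obj.ι)
    (h₁π : k₁.hom ≫ G₁'.obj.π = e.functor.map G₁.obj.π)
    (k₂ : e.functor.obj G₂.obj.mid ≅ G₂'.obj.mid) (h₂ι : e.functor.map G₂.obj.ι ≫ k₂.hom = G₂'.obj.ι)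
    (h₂π : k₂.hom ≫ G₂'.obj.π = e.functor.map G₂.obj.π) :
    Nonempty (G₁ ⟶ G₂) ↔ Nonempty (G₁' ⟶ G₂') := by
  constructor
  · rintro ⟨g⟩
    refine ⟨ObjectProperty.homMk ⟨k₁.inv ≫ e.functor.map g.hom.h ≫ k₂.hom, ?_, ?_⟩⟩
    · rw [← h₁ι, ← h₂ι]
      simp only [Category.assoc, Iso.hom_inv_id_assoc]
      rw [← e.functor.map_comp_assoc, g.hom.ι_h]
    · simp only [Category.assoc]
      rw [h₂π, ← e.functor.map_comp, g.hom.h_π, ← h₁π, Iso.inv_hom_id_assoc]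
  · rintro ⟨g'⟩
    refine ⟨ObjectProperty.homMk ⟨e.functor.preimage (k₁.hom ≫ g'.hom.h ≫ k₂.inv), ?_, ?_⟩⟩
    · apply e.functor.map_injective
      rw [Functor.map_comp, Functor.map_preimage, (k₂.eq_comp_inv).mpr h₂ι, ← Category.assoc, h₁ι,
        ← Category.assoc, g'.hom.ι_h]
    · apply e.functor.map_injective
      rw [Functor.map_comp, Functor.map_preimage, ← h₁π, ← h₂π]
      simp only [Category.assoc, Iso.inv_hom_id_assoc, g'.hom.h_π]

/-- Any two mono-factorisations of `e(φ)` are comparable iff any two mono-factorisations of `φ` are.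
[cite: MochizukiFrdII2008, §0 p.6] -/
theorem monoFactorisations_comparable_iff_equivalence {A B : C} (φ : A ⟶ B) :
    (∀ G₁' G₂' : MonoFactorisations (e.functor.map φ), Nonempty (G₁' ⟶ G₂') ∨ Nonempty (G₂' ⟶ G₁')) ↔
      ∀ G₁ G₂ : MonoFactorisations φ, Nonempty (G₁ ⟶ G₂) ∨ Nonempty (G₂ ⟶ G₁) := by
  constructor
  · intro h
    refine comparable_transfer
      (fun (G' : MonoFactorisations (e.functor.map φ)) (G : MonoFactorisations φ) =>
        ∃ k : e.functor.obj G.obj.mid ≅ G'.obj.mid,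
          e.functor.map G.obj.ι ≫ k.hom = G'.obj.ι ∧ k.hom ≫ G'.obj.π = e.functor.map G.obj.π)
      (fun G => ?_) (fun hR₁ hR₂ => ?_) h
    · obtain ⟨G', k, hk⟩ := MonoFactorisations.exists_image_equivalence e G
      exact ⟨G', k, hk⟩
    · obtain ⟨k₁, h₁ι, h₁π⟩ := hR₁
      obtain ⟨k₂, h₂ι, h₂π⟩ := hR₂
      exact (MonoFactorisations.nonempty_hom_iff_equivalence e k₁ h₁ι h₁π k₂ h₂ι h₂π).symm
  · intro h
    refine comparable_transfer
      (fun (G : MonoFactorisations φ) (G' : MonoFactorisations (e.functor.map φ)) =>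
        ∃ k : e.functor.obj G.obj.mid ≅ G'.obj.mid,
          e.functor.map G.obj.ι ≫ k.hom = G'.obj.ι ∧ k.hom ≫ G'.obj.π = e.functor.map G.obj.π)
      (fun G' => ?_) (fun hR₁ hR₂ => ?_) h
    · obtain ⟨G, k, hk⟩ := MonoFactorisations.exists_preimage_equivalence e G'
      exact ⟨G, k, hk⟩
    · obtain ⟨k₁, h₁ι, h₁π⟩ := hR₁
      obtain ⟨k₂, h₂ι, h₂π⟩ := hR₂
      exact MonoFactorisations.nonempty_hom_iff_equivalence e k₁ h₁ι h₁π k₂ h₂ι h₂π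

/-- `C^↣_φ` is densely ordered iff `D^↣_{e(φ)}` is. [cite: MochizukiFrdII2008, §0 p.6] -/
theorem monoFactorisations_dense_iff_equivalence {A B : C} (φ : A ⟶ B) :
    (∀ G₁' G₂' : MonoFactorisations (e.functor.map φ), Nonempty (G₁' ⟶ G₂') → IsEmpty (G₂' ⟶ G₁') →
        ∃ G₃' : MonoFactorisations (e.functor.map φ), Nonempty (G₁' ⟶ G₃') ∧ IsEmpty (G₃' ⟶ G₁') ∧
          Nonempty (G₃' ⟶ G₂') ∧ IsEmpty (G₂' ⟶ G₃')) ↔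
      ∀ G₁ G₂ : MonoFactorisations φ, Nonempty (G₁ ⟶ G₂) → IsEmpty (G₂ ⟶ G₁) →
        ∃ G₃ : MonoFactorisations φ, Nonempty (G₁ ⟶ G₃) ∧ IsEmpty (G₃ ⟶ G₁) ∧
          Nonempty (G₃ ⟶ G₂) ∧ IsEmpty (G₂ ⟶ G₃) := by
  constructor
  · intro h
    refine dense_transfer
      (fun (G' : MonoFactorisations (e.functor.map φ)) (G : MonoFactorisations φ) =>
        ∃ k : e.functor.obj G.obj.mid ≅ G'.obj.mid,
          e.functor.map G.obj.ι ≫ k.hom = G'.obj.ι ∧ k.hom ≫ G'.obj.π = e.functor.map G.obj.π)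
      (fun G => ?_) (fun G' => ?_) (fun hR₁ hR₂ => ?_) h
    · obtain ⟨G', k, hk⟩ := MonoFactorisations.exists_image_equivalence e G
      exact ⟨G', k, hk⟩
    · obtain ⟨G, k, hk⟩ := MonoFactorisations.exists_preimage_equivalence e G'
      exact ⟨G, k, hk⟩
    · obtain ⟨k₁, h₁ι, h₁π⟩ := hR₁
      obtain ⟨k₂, h₂ι, h₂π⟩ := hR₂
      exact (MonoFactorisations.nonempty_hom_iff_equivalence e k₁ h₁ι h₁π k₂ h₂ι h₂π).symm
  · intro h
    refine dense_transfer
      (fun (G : MonoFactorisations φ) (G' : MonoFactorisations (e.functor.map φ)) =>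
        ∃ k : e.functor.obj G.obj.mid ≅ G'.obj.mid,
          e.functor.map G.obj.ι ≫ k.hom = G'.obj.ι ∧ k.hom ≫ G'.obj.π = e.functor.map G.obj.π)
      (fun G' => ?_) (fun G => ?_) (fun hR₁ hR₂ => ?_) h
    · obtain ⟨G, k, hk⟩ := MonoFactorisations.exists_preimage_equivalence e G'
      exact ⟨G, k, hk⟩
    · obtain ⟨G', k, hk⟩ := MonoFactorisations.exists_image_equivalence e G
      exact ⟨G', k, hk⟩
    · obtain ⟨k₁, h₁ι, h₁π⟩ := hR₁
      obtain ⟨k₂, h₂ι, h₂π⟩ := hR₂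
      exact MonoFactorisations.nonempty_hom_iff_equivalence e k₁ h₁ι h₁π k₂ h₂ι h₂π

/-! ### Totally / continuously ordered monomorphisms under an equivalence -/

/-- `e(φ)` is totally ordered iff `φ` is ("category-theoretic", §0 p. 6).
[cite: MochizukiFrdII2008, §0 p.6] -/
theorem isTotallyOrderedHom_map_equivalence_iff {A B : C} (φ : A ⟶ B) :
    IsTotallyOrderedHom (e.functor.map φ) ↔ IsTotallyOrderedHom φ := by
  rw [isTotallyOrderedHom_iff, isTotallyOrderedHom_iff, monoFactorisations_comparable_iff_equivalence,
    e.functor.mono_map_iff_mono]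

/-- `e(φ)` is continuously ordered iff `φ` is. [cite: MochizukiFrdII2008, §0 p.6] -/
theorem isContinuouslyOrderedHom_map_equivalence_iff {A B : C} (φ : A ⟶ B) :
    IsContinuouslyOrderedHom (e.functor.map φ) ↔ IsContinuouslyOrderedHom φ := by
  rw [isContinuouslyOrderedHom_iff, isContinuouslyOrderedHom_iff,
    monoFactorisations_comparable_iff_equivalence, monoFactorisations_dense_iff_equivalence,
    e.functor.mono_map_iff_mono]

/-! ### Four of the six ordered types under an equivalence -/

/-- A category equivalent to one of totally ordered type is of totally ordered type.
[cite: MochizukiFrdII2008, §0 p.6] -/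
theorem IsOfTotallyOrderedType.of_equivalence (e : C ≌ D) (h : IsOfTotallyOrderedType C) :
    IsOfTotallyOrderedType D :=
  ⟨fun φ' => (isTotallyOrderedHom_map_equivalence_iff e.symm φ').mp (h.isTotallyOrderedHom _)⟩

/-- Being of totally ordered type is invariant under equivalence of categories.
[cite: MochizukiFrdII2008, §0 p.6] -/
theorem isOfTotallyOrderedType_iff_of_equivalence (e : C ≌ D) :
    IsOfTotallyOrderedType C ↔ IsOfTotallyOrderedType D :=
  ⟨fun h => h.of_equivalence e, fun h => h.of_equivalence e.symm⟩

/-- A category equivalent to one of continuously ordered type is of continuously ordered type.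
[cite: MochizukiFrdII2008, §0 p.6] -/
theorem IsOfContinuouslyOrderedType.of_equivalence (e : C ≌ D) (h : IsOfContinuouslyOrderedType C) :
    IsOfContinuouslyOrderedType D :=
  ⟨fun φ' => (isContinuouslyOrderedHom_map_equivalence_iff e.symm φ').mp
    (h.isContinuouslyOrderedHom _)⟩

/-- Being of continuously ordered type is invariant under equivalence of categories.
[cite: MochizukiFrdII2008, §0 p.6] -/
theorem isOfContinuouslyOrderedType_iff_of_equivalence (e : C ≌ D) :
    IsOfContinuouslyOrderedType C ↔ IsOfContinuouslyOrderedType D :=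
  ⟨fun h => h.of_equivalence e, fun h => h.of_equivalence e.symm⟩

/-- A category equivalent to one of strictly partially ordered type is of strictly partially ordered
type (`e⁻¹` preserves totally ordered arrows and reflects isomorphisms).
[cite: MochizukiFrdII2008, §0 p.6] -/
theorem IsOfStrictlyPartiallyOrderedType.of_equivalence (e : C ≌ D)
    (h : IsOfStrictlyPartiallyOrderedType C) : IsOfStrictlyPartiallyOrderedType D :=
  ⟨fun φ' hφ' => isIso_of_map_isIso_equivalence e.symm φ'
    (h.isIso _ ((isTotallyOrderedHom_map_equivalence_iff e.symm φ').mpr hφ'))⟩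

/-- Being of strictly partially ordered type is invariant under equivalence of categories.
[cite: MochizukiFrdII2008, §0 p.6] -/
theorem isOfStrictlyPartiallyOrderedType_iff_of_equivalence (e : C ≌ D) :
    IsOfStrictlyPartiallyOrderedType C ↔ IsOfStrictlyPartiallyOrderedType D :=
  ⟨fun h => h.of_equivalence e, fun h => h.of_equivalence e.symm⟩

/-- A category equivalent to one of discontinuously ordered type is of discontinuously ordered type.
[cite: MochizukiFrdII2008, §0 p.6] -/
theorem IsOfDiscontinuouslyOrderedType.of_equivalence (e : C ≌ D)
    (h : IsOfDiscontinuouslyOrderedType C) : IsOfDiscontinuouslyOrderedType D :=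
  ⟨fun φ' hφ' => isIso_of_map_isIso_equivalence e.symm φ'
    (h.isIso _ ((isContinuouslyOrderedHom_map_equivalence_iff e.symm φ').mpr hφ'))⟩

/-- Being of discontinuously ordered type is invariant under equivalence of categories.
[cite: MochizukiFrdII2008, §0 p.6] -/
theorem isOfDiscontinuouslyOrderedType_iff_of_equivalence (e : C ≌ D) :
    IsOfDiscontinuouslyOrderedType C ↔ IsOfDiscontinuouslyOrderedType D :=
  ⟨fun h => h.of_equivalence e, fun h => h.of_equivalence e.symm⟩

end Equivalence

end Literature.AlgebraicGeometry.Frobenioids
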